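import Literature.MathematicalPhysics.QuantumFieldTheory.Balaban1983to89.B9Ineq349L2Readings
import Literature.MathematicalPhysics.QuantumFieldTheory.Balaban1983to89.B9Eq376L2DerivDict

/-!
# `Balaban1983to89.B9Ineq349L2HomReadings` — B9 p. 399 (3.49) IN BLOCK-`ℓ²`, THE THREE ENTRIES OF `P(U)`'s WORD `R₀(U) = G′Q′*C⁻¹Q′G′` IN THE
# TWO-CARRIER SHAPES THE (3.77)-BRICK CONSUMES, FROM READINGS

The (3.77) brick `B9Ineq377L2Hom.ineq377_l2_concreteE` takes the (3.49) entries of the site-carrier word `P = P(U)` as three block-`ℓ²` hypotheses: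
`hP : P ≺₂ κ_P e^{−δd}` (one carrier), `hDP : D∘P ≺₂ κ_P(Lʲη)⁻¹e^{−δd}` (sites → bonds, `D = conjHom b (η⁻¹D¹_U)`), `hPDs : P∘D* ≺₂ κ_P(Lʲη)⁻¹e^{−δd}`
(bonds → sites).  `B9Ineq349L2Readings.ineq349_l2_of_readings` (g5) derives the ONE-CARRIER entries `GMG`, `∇·GMG`, `GMG·∇*` from READINGS (structured
block-`ℓ²` Hom-readings of `Q′`, `Q′*`, the (3.48) entry bound of `C⁻¹` on 𝔅, Theorem 3.1's block-`ℓ²` members of `G′(U)`), per concrete difference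
letter; the referee's NIT (ref-E g8 READ-2, 2026-08-27) was that the passage to the TWO-CARRIER shapes `hDP`∕`hPDs` was "pattern-only".  THIS FILE writes
it out: the per-direction one-carrier entries for the directional letters `∇_μ = diffLetter (Sum.inl μ)`, `∇♯_ν = diffLetter (Sum.inr ν)` assemble into
the Hom-shaped entries by `B9Eq376L2DerivDict.hasL2MajorantHom_gradLin_comp` ∕ `…_comp_divLin` (factor `√#κ`), so ALL THREE hypotheses of the
(3.77)-brick for `P := R₀(U) = G ∘ Q′* ∘ C⁻¹ ∘ Q′ ∘ G` hold with the common constant `(1 + √#κ)·κ₃₄₉` — from readings only.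

HONEST SCOPE.  Finite-dimensional bookkeeping; every letter a binder with its reading as hypothesis; nothing of [B9] asserted for Bałaban's operators;
count-neutral; NOT a node discharge; nothing continuum ∕ OS ∕ mass-gap ∕ Clay.  Cell `pub-ymgap` (HUMAN RULING D-0062), Track A node N06 [B9],
N06-ASSIGNMENT row 13 (G-side `ℓ²` route, GSIDE-L2-SPEC v4 item F1), seat `pub-ymgap-dag-n06-c` (g6), 2026-08-27.
-/

noncomputable section

open scoped BigOperators

namespace Literature.MathematicalPhysics.QuantumFieldTheory.Balaban1983to89.B9Ineq349L2HomReadings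

open Literature.MathematicalPhysics.QuantumFieldTheory.Balaban1983to89
open Literature.MathematicalPhysics.QuantumFieldTheory.Balaban1983to89.B6RandomWalk (Triangle254 Ineq261)
open Literature.MathematicalPhysics.QuantumFieldTheory.Balaban1983to89.B6RandomWalkL2 (HasL2Majorant hasL2Majorant_mono hasL2Majorant_zero)
open Literature.MathematicalPhysics.QuantumFieldTheory.Balaban1983to89.B6RandomWalkL2Hom (HasL2MajorantHom hasL2MajorantHom_mono)
open Literature.MathematicalPhysics.QuantumFieldTheory.Balaban1983to89.B9Thm34Ext (toB6)
open Literature.MathematicalPhysics.QuantumFieldTheory.Balaban1983to89.B9Ineq347 (ScaleTransfer)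
open Literature.MathematicalPhysics.QuantumFieldTheory.Balaban1983to89.B9Eq352DivFormLetters (conj)
open Literature.MathematicalPhysics.QuantumFieldTheory.Balaban1983to89.B9Eq352GradLetters (diffLetter)
open Literature.MathematicalPhysics.QuantumFieldTheory.Balaban1983to89.B9Eq376POneLetters (conjHom gradLin divLin)
open Literature.MathematicalPhysics.QuantumFieldTheory.Balaban1983to89.B9Ineq349L2Readings (ineq349_l2_of_readings)
open Literature.MathematicalPhysics.QuantumFieldTheory.Balaban1983to89.B9Eq376L2DerivDict (hasL2MajorantHom_gradLin_comp hasL2MajorantHom_comp_divLin)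

variable {𝔸 : Type*} [NormedRing 𝔸] [NormedAlgebra ℂ 𝔸] {ι : Type} [Fintype ι]
variable (b : Module.Basis ι ℝ 𝔸) {S : Type} [Fintype S] {κ : Type} [Fintype κ]
variable (T : κ → Equiv.Perm S) (U : κ → S → 𝔸ˣ)
variable {g : B9.Geometry} [Fintype g.Site] [DecidableEq g.Site] {R : ℝ} {H : Prop}

/-- ★★ **THE THREE (3.49) ENTRIES OF `P(U) = R₀(U) = G′∘Q′*∘C⁻¹∘Q′∘G′` IN THE SHAPES OF THE (3.77)-BRICK, FROM READINGS**: structured block-`ℓ²`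
Hom-readings of `Q′ : X → 𝔅` (`κ_c·w_c(y)𝟙`), `Q′* : 𝔅 → X` (`κ_s·w_s(y)𝟙`, `w_s·w_c ≦ 1`, the volume transfer of `w_c` at `(δ_C, α_C)`), the (3.48)
ENTRY bound of `C⁻¹` on 𝔅, Theorem 3.1's block-`ℓ²` members of `G′(U)` at the rate `δ` — (3.46)₀ and, PER DIRECTION, (3.46)₁ for the directional
letters `∇_μ` and (3.46)₂ for `∇♯_ν` (coefficient `c`, print `c = η⁻¹`) — and the located devices' geometry give, for `ρ + (2α+β)δ₀ ≦ δ ≦ (1−α_C)δ_C`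
and `κ_P = (1 + √#κ)·κ₃₄₉(1, B₀, κ_sκ_cB_CΛ_C, Λ, c₁(β))`: `P ≺₂ κ_P e^{−ρd}`, `D∘P ≺₂ κ_P(Lʲη)⁻¹e^{−ρd}` (sites → bonds), `P∘D* ≺₂ κ_P(Lʲη)⁻¹e^{−ρd}`
(bonds → sites) — exactly the hypotheses `hP`, `hDP`, `hPDs` of `B9Ineq377L2Hom.ineq377_l2_concreteE` for `P := G ∘ Q′* ∘ C⁻¹ ∘ Q′ ∘ G`.  Route:
`B9Ineq349L2Readings.ineq349_l2_of_readings` per direction (the unused side letter set to `0`), then `B9Eq376L2DerivDict.hasL2MajorantHom_gradLin_comp`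
∕ `hasL2MajorantHom_comp_divLin` (the `√#κ` of the direction sum), constants merged to `κ_P`.
[cite: Balaban1985BackgroundPropagators, (3.25) p.394 + (3.48)–(3.49) pp.398–399 + (3.76)–(3.77) pp.405–406 + (3.8) p.392; Balaban1984PropagatorsII, Lemma 2.1 p.234 + (2.52)–(2.55) p.232 + Prop. 2.6 (2.140)–(2.141) p.247] -/
theorem ineq349_l2Hom_of_readings (blk : S → g.Site) (d : ℕ) (c : ℂ) (δ₀ δ α β ρ Λ B₀ δC αC ΛC κc κs BC : ℝ) (wc ws : g.Site → ℝ)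
    (hB₀ : 0 ≤ B₀) (hΛ : 1 ≤ Λ) (hρ : 0 ≤ ρ) (hα : 0 ≤ α) (hβ : 0 ≤ β) (hδ₀ : 0 ≤ δ₀) (hr : ρ + (2 * α + β) * δ₀ ≤ δ)
    (hκc : 0 ≤ κc) (hκs : 0 ≤ κs) (hBC : 0 ≤ BC) (hΛC : 0 ≤ ΛC) (hws : ∀ a, 0 ≤ ws a) (hprod : ∀ a, ws a * wc a ≤ 1)
    (hδC : δ ≤ (1 - αC) * δC)
    (hdnn : ∀ a a' : g.Site, 0 ≤ g.dist a a') (htri : Triangle254 (toB6 g R H)) (hlen : ∀ y : g.Site, 0 < g.len y)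
    (h261 : Ineq261 d (toB6 g R H) δ₀ β)
    (hT1 : ScaleTransfer g δ₀ α Λ (fun a => g.len a)) (hT2 : ScaleTransfer g δ₀ α Λ (fun a => g.len a ^ 2))
    (hT4 : ScaleTransfer g δ₀ α Λ (fun a => (g.len a ^ 4)⁻¹))
    (hTC : ∀ a a' : g.Site, Real.exp (-(αC * δC * g.dist a a')) * wc a' ≤ ΛC * wc a)
    {G : Module.End ℝ (S × ι → ℝ)}
    {Qc : (S × ι → ℝ) →ₗ[ℝ] (g.Site → ℝ)} {Cop : Module.End ℝ (g.Site → ℝ)} {Qcs : (g.Site → ℝ) →ₗ[ℝ] (S × ι → ℝ)}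
    (hG : HasL2Majorant (g := toB6 g R H) (fun p : S × ι => blk p.1) G (fun a a' => B₀ * g.len a ^ 2 * Real.exp (-(δ * g.dist a a'))))
    (hDG : ∀ μ : κ, HasL2Majorant (g := toB6 g R H) (fun p : S × ι => blk p.1) (conj b (diffLetter T U c (Sum.inl μ)) * G)
      (fun a a' => B₀ * g.len a * Real.exp (-(δ * g.dist a a'))))
    (hGDs : ∀ ν : κ, HasL2Majorant (g := toB6 g R H) (fun p : S × ι => blk p.1) (G * conj b (diffLetter T U c (Sum.inr ν)))
      (fun a a' => B₀ * g.len a * Real.exp (-(δ * g.dist a a'))))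
    (hQc : HasL2MajorantHom (g := toB6 g R H) (fun p : S × ι => blk p.1) (fun z : g.Site => z) Qc
      (fun a a' : g.Site => if a = a' then κc * wc a else 0))
    (hQcs : HasL2MajorantHom (g := toB6 g R H) (fun z : g.Site => z) (fun p : S × ι => blk p.1) Qcs
      (fun a a' : g.Site => if a = a' then κs * ws a else 0))
    (h348 : ∀ y y' : g.Site, |Cop (Pi.single y' 1) y| ≤ BC * (g.len y ^ 4)⁻¹ * Real.exp (-(δC * g.dist y y'))) :
    HasL2Majorant (g := toB6 g R H) (fun p : S × ι => blk p.1) (G ∘ₗ Qcs ∘ₗ Cop ∘ₗ Qc ∘ₗ G)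
        (fun a a' => (1 + Real.sqrt (Fintype.card κ)) * B9Ineq368PPrime.kappa349 1 B₀ (κs * κc * BC * ΛC) Λ (B6.c1 d δ₀ β) *
          Real.exp (-(ρ * g.dist a a'))) ∧
      HasL2MajorantHom (g := toB6 g R H) (fun p : S × ι => blk p.1) (fun q : (κ × S) × ι => blk q.1.2)
        (conjHom b (gradLin T c U) ∘ₗ (G ∘ₗ Qcs ∘ₗ Cop ∘ₗ Qc ∘ₗ G))
        (fun a a' => (1 + Real.sqrt (Fintype.card κ)) * B9Ineq368PPrime.kappa349 1 B₀ (κs * κc * BC * ΛC) Λ (B6.c1 d δ₀ β) *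
          (g.len a)⁻¹ * Real.exp (-(ρ * g.dist a a'))) ∧
      HasL2MajorantHom (g := toB6 g R H) (fun q : (κ × S) × ι => blk q.1.2) (fun p : S × ι => blk p.1)
        ((G ∘ₗ Qcs ∘ₗ Cop ∘ₗ Qc ∘ₗ G) ∘ₗ conjHom b (divLin T c U))
        (fun a a' => (1 + Real.sqrt (Fintype.card κ)) * B9Ineq368PPrime.kappa349 1 B₀ (κs * κc * BC * ΛC) Λ (B6.c1 d δ₀ β) *
          (g.len a)⁻¹ * Real.exp (-(ρ * g.dist a a'))) := by
  set κ₀ : ℝ := B9Ineq368PPrime.kappa349 1 B₀ (κs * κc * BC * ΛC) Λ (B6.c1 d δ₀ β) with hκ₀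
  have hκ₀0 : 0 ≤ κ₀ := by rw [hκ₀]; unfold B9Ineq368PPrime.kappa349; positivity
  have hsq : 0 ≤ Real.sqrt (Fintype.card κ) := Real.sqrt_nonneg _
  have hw1i : ∀ a : g.Site, 0 ≤ (g.len a)⁻¹ := fun a => inv_nonneg.mpr (hlen a).le
  -- the word as a product: `G ∘ Q′* ∘ C⁻¹ ∘ Q′ ∘ G = G * (Q′* ∘ C⁻¹ ∘ Q′) * G`
  have e : G ∘ₗ Qcs ∘ₗ Cop ∘ₗ Qc ∘ₗ G = G * (Qcs ∘ₗ Cop ∘ₗ Qc) * G := rfl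
  -- the zero letter is a member of every shape
  have hZl : HasL2Majorant (g := toB6 g R H) (fun p : S × ι => blk p.1) ((0 : Module.End ℝ (S × ι → ℝ)) * G)
      (fun a a' => B₀ * g.len a * Real.exp (-(δ * g.dist a a'))) := by
    rw [zero_mul]
    exact hasL2Majorant_mono (g := toB6 g R H) _ (hasL2Majorant_zero (g := toB6 g R H) _) fun a a' =>
      mul_nonneg (mul_nonneg hB₀ (hlen a).le) (Real.exp_nonneg _)
  have hZr : HasL2Majorant (g := toB6 g R H) (fun p : S × ι => blk p.1) (G * (0 : Module.End ℝ (S × ι → ℝ)))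
      (fun a a' => B₀ * g.len a * Real.exp (-(δ * g.dist a a'))) := by
    rw [mul_zero]
    exact hasL2Majorant_mono (g := toB6 g R H) _ (hasL2Majorant_zero (g := toB6 g R H) _) fun a a' =>
      mul_nonneg (mul_nonneg hB₀ (hlen a).le) (Real.exp_nonneg _)
  -- (3.49) from the readings, per direction letter
  have call := fun (D Ds : Module.End ℝ (S × ι → ℝ))
      (hD : HasL2Majorant (g := toB6 g R H) (fun p : S × ι => blk p.1) (D * G) (fun a a' => B₀ * g.len a * Real.exp (-(δ * g.dist a a'))))
      (hDs : HasL2Majorant (g := toB6 g R H) (fun p : S × ι => blk p.1) (G * Ds) (fun a a' => B₀ * g.len a * Real.exp (-(δ * g.dist a a')))) =>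
    ineq349_l2_of_readings (R := R) (H := H) (fun p : S × ι => blk p.1) d δ₀ δ α β ρ Λ B₀ δC αC ΛC κc κs BC wc ws hB₀ hΛ hρ hα hβ hδ₀ hr
      hκc hκs hBC hΛC hws hprod hδC hdnn htri hlen h261 hT1 hT2 hT4 hTC hG hD hDs hQc hQcs h348
  obtain ⟨hP, -, -, -⟩ := call 0 0 hZl hZr
  have hDP : ∀ μ : κ, HasL2Majorant (g := toB6 g R H) (fun p : S × ι => blk p.1)
      (conj b (diffLetter T U c (Sum.inl μ)) * (G * (Qcs ∘ₗ Cop ∘ₗ Qc) * G))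
      (fun a a' => κ₀ * (g.len a)⁻¹ * Real.exp (-(ρ * g.dist a a'))) :=
    fun μ => (call _ 0 (hDG μ) hZr).2.1
  have hPDs : ∀ ν : κ, HasL2Majorant (g := toB6 g R H) (fun p : S × ι => blk p.1)
      (G * (Qcs ∘ₗ Cop ∘ₗ Qc) * G * conj b (diffLetter T U c (Sum.inr ν)))
      (fun a a' => κ₀ * (g.len a)⁻¹ * Real.exp (-(ρ * g.dist a a'))) :=
    fun ν => (call 0 _ hZl (hGDs ν)).2.2.1
  -- the direction sums (√#κ) and the common constant `(1 + √#κ)κ₀`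
  have hK0 : ∀ a a' : g.Site, 0 ≤ κ₀ * (g.len a)⁻¹ * Real.exp (-(ρ * g.dist a a')) := fun a a' => by
    have := hw1i a; positivity
  have hHomD := hasL2MajorantHom_gradLin_comp (R := R) (H := H) b T U blk c hDP
  have hHomDs := hasL2MajorantHom_comp_divLin (R := R) (H := H) b T U blk c hK0 hPDs
  rw [e]
  refine ⟨?_, ?_, ?_⟩
  · refine hasL2Majorant_mono (g := toB6 g R H) _ hP fun a a' => ?_
    have h0 : 0 ≤ κ₀ * Real.exp (-(ρ * g.dist a a')) := by positivity
    have h1 : (1 : ℝ) ≤ 1 + Real.sqrt (Fintype.card κ) := le_add_of_nonneg_right hsq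
    calc κ₀ * Real.exp (-(ρ * g.dist a a')) = 1 * (κ₀ * Real.exp (-(ρ * g.dist a a'))) := (one_mul _).symm
      _ ≤ (1 + Real.sqrt (Fintype.card κ)) * (κ₀ * Real.exp (-(ρ * g.dist a a'))) := mul_le_mul_of_nonneg_right h1 h0
      _ = _ := by ring
  · refine hasL2MajorantHom_mono (g := toB6 g R H) _ _ hHomD fun a a' => ?_
    have h0 := hK0 a a'
    have h1 : Real.sqrt (Fintype.card κ) ≤ 1 + Real.sqrt (Fintype.card κ) := le_add_of_nonneg_left zero_le_one
    calc Real.sqrt (Fintype.card κ) * (κ₀ * (g.len a)⁻¹ * Real.exp (-(ρ * g.dist a a')))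
        ≤ (1 + Real.sqrt (Fintype.card κ)) * (κ₀ * (g.len a)⁻¹ * Real.exp (-(ρ * g.dist a a'))) := mul_le_mul_of_nonneg_right h1 h0
      _ = _ := by ring
  · refine hasL2MajorantHom_mono (g := toB6 g R H) _ _ hHomDs fun a a' => ?_
    have h0 := hK0 a a'
    have h1 : Real.sqrt (Fintype.card κ) ≤ 1 + Real.sqrt (Fintype.card κ) := le_add_of_nonneg_left zero_le_one
    calc Real.sqrt (Fintype.card κ) * (κ₀ * (g.len a)⁻¹ * Real.exp (-(ρ * g.dist a a')))
        ≤ (1 + Real.sqrt (Fintype.card κ)) * (κ₀ * (g.len a)⁻¹ * Real.exp (-(ρ * g.dist a a'))) := mul_le_mul_of_nonneg_right h1 h0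
      _ = _ := by ring

end Literature.MathematicalPhysics.QuantumFieldTheory.Balaban1983to89.B9Ineq349L2HomReadings
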